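import Summits.QuantumFields.YangMills.Theorems.LuscherReductionTwistedTraceScalingInnerTwoZone
import Summits.QuantumFields.YangMills.Theorems.FlatTubeReductionNearFlatOfBORate
import Summits.QuantumFields.YangMills.Theorems.LuscherReductionOneSiteLevelsClosed
import Summits.QuantumFields.YangMills.Theorems.LuscherReductionOneSiteLevelsAbsLower
import Summits.QuantumFields.YangMills.Theorems.LuscherReductionTwistedTraceScalingBOAssemblyPrelim
import Summits.QuantumFields.YangMills.Theorems.LuscherReductionTwistedTraceScalingInnerOfTube
import HarnessLib

/-!
# «ratepack-v2»: the RATE-GRADE TWO-ZONE glue — INNER RATE at radius `δ` ⟸ INNER RATE on a CORE of radius `δc ≍ √λ_b(L³β)` + lane A's SHELL GAIN on `(δc, δ)`,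
# the IMS cut at the core radius costing `O(λ_b²)·λ₀` (core exponent `s = 1/6` EXACTLY); hence K1 ⟸ CORE RATE + SHELL
# (route `FlatTubeReduction`, crux K1 `NearFlatRatioLaw` stmt-QuantumFields-24720; seat `ym-line-ftr-p1` g10; R2b1 RECORD rung — no summit statement is proved here)

WHY (crux workfile `Cruxes/NearFlatRatioLaw/Lines/ratepack-dressing-g10.md` §4): the dressed one-site no-intruder of the rate twin (`dressedOneOrbitRate_of_eigenMoments`, p660362)
only works on a slow window of radius `O((L³β)^{-1/6})` (the cluster gap must absorb `κ_W·δ₁²`), while the FTR chain (`nearFlatRatioLaw_of_innerRate`, p626045) consumes the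
inner RATE at radius `β^{-1/40}`.  The annulus is FIRST-ORDER territory: lane A's `InnerShellGainAt L δc δ` (C4-SHELL, parametric and monotone in the inner radius) gives a
gain `e^{−Aλ_b}` for every `A`, and the lattice IMS cut `qform_le_inner_outer_lat` at radius `δc` costs `½|E|²(8π/δc)²(3/β)c_β^{|E|}·‖ψ‖²`, which is `≤ D·λ_b(L³β)²·(uniform floor)
≤ Dλ_b²·λ₀` EXACTLY when `δc² ≳ 1/(βλ_b²) ≍ λ_b(L³β)·L³/2`, i.e. `δc ≍ √λ_b` — rate grade with a constant, no slack (this is why the core exponent is `1/6` and not more).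
* ★★★ `innerRate_of_core_shell` — for every level `k`: CORE RATE at `δc` (families supported in `{∃z, orbitDist(τ_zU) < δc}`, factor `e^{Cλ²}`) + `InnerShellGainAt L δc δ` + the
  rate admissibility of `δc` ⟹ INNER RATE at `δ` (factor `e^{(|C|+2D)λ²}`).  Proof: cut each combination at `δc`; the `cos`-piece family is a core family (or degenerate, then its
  form vanishes), the `sin`-piece sits in the shell (`e^{−Aλ}λ₀ ≤ μ_k/μ₀·λ₀` by crux ONE), the cut is `≤ 2Dλ²μ_kλ₀/μ₀`-small.
* ★ `coreRadius_admissible` — `δc β := c·√λ_b(L³β)` (`c > 0`) is rate-admissible with `D = 48π²|E|²L³/(c²·uniformFloorConst L)` (`βλ_b³L³ = 2`).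
* ★★★★ `nearFlatRatioLaw_of_coreRate_shell` — K1 ⟸ ∀ L ≥ 2: CORE RATE at `k = 1` on radius `c_L√λ_b(L³β)` ∧ `InnerShellGainAt L (c_L√λ_b(L³·)) (β^{-1/40})`.
HONEST FRAMING: glue; the CORE RATE (rate-grade Born–Oppenheimer on the core: fibre bricks + the dressed one-site no-intruder modulo (EM)) and the SHELL GAIN (lane A's C4-SHELL) are
OPEN fixed-lattice semiclassics; femto rung R2b1 (RECORD label); not infinite volume, not a gap, not Clay.  No defs, no named facts, no `sorry`.
-/

set_option autoImplicit false

noncomputable section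

open MeasureTheory Filter Topology Real
open scoped BigOperators
open Literature.MathematicalPhysics.QuantumFieldTheory
open Literature.MathematicalPhysics.QuantumLattice

namespace Summit.QuantumFields.YangMills.Theorems.FemtoTransferGap.RateTube

open Summit.QuantumFields.YangMills.Theorems.FemtoTransferGap
open Summit.QuantumFields.YangMills.Theorems.FemtoTransferGap.TwoLattice.ConstTube (qform_eq_zero_of_integral_sq_eq_zero l2_self_eq_integral_sq)

variable {L : ℕ} [NeZero L]

/-! ## §1 ★★★ The rate-grade two-zone glue -/

set_option maxHeartbeats 400000 in
/-- ★★★ **INNER RATE at radius `δ` ⟸ CORE RATE at radius `δc` + SHELL GAIN on `(δc, δ)` + rate admissibility of the core radius.**  For every level `k`: if (i) eventually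
`0 < δc β` and the IMS defect at radius `δc β` is `≤ D·λ_b(L³β)²·(uniformFloorConst L·c_β^{|E|})`, (ii) eventually every physical `(k+1)`-family supported in `{∃ z, orbitDist(τ_z U) < δc β}`
with nondegenerate Gram matrix has a combination with `⟨ψ,Kψ⟩μ₀ ≤ e^{Cλ²}μ_kλ₀‖ψ‖²`, and (iii) `InnerShellGainAt L δc δ`, then (ii) holds at radius `δ` with `e^{(|C|+2D)λ²}`.
[cite: Luscher1983, §3] [cite: SimonB1983DiscreteSpectrum, §3] -/
theorem innerRate_of_core_shell (k : ℕ) {δc δ : ℝ → ℝ} {D : ℝ} (hD : 0 ≤ D)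
    (hadm : ∃ β1 : ℝ, ∀ β : ℝ, β1 ≤ β → 0 < δc β ∧
      (1 / 2) * ((Fintype.card (Edge 3 L) : ℝ) ^ 2 * (8 * π / δc β) ^ 2 * (3 / β) * latCE L β) ≤
        D * bareLambda ((L : ℝ) ^ 3 * β) ^ 2 * (uniformFloorConst L * latCE L β))
    (hcore : ∃ C βc : ℝ, ∀ β : ℝ, βc ≤ β →
      ∀ F : Fin (k + 1) → (GaugeConfig 3 L SU2 → ℝ), (∀ i, IsPhys (F i)) →
        (∀ i U, F i U ≠ 0 → ∃ z : Fin 3 → Bool, orbitDist (TT.twist3 z U) < δc β) →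
        (∀ a : Fin (k + 1) → ℝ, a ≠ 0 → 0 < l2 (fun U => ∑ i, a i * F i U) (fun U => ∑ i, a i * F i U)) →
          ∃ a : Fin (k + 1) → ℝ, a ≠ 0 ∧
            qform su2Rep β (fun U => ∑ i, a i * F i U) (fun U => ∑ i, a i * F i U) * levelValue su2Rep 1 ((L : ℝ) ^ 3 * β) 0 ≤
              Real.exp (C * bareLambda ((L : ℝ) ^ 3 * β) ^ 2) * levelValue su2Rep 1 ((L : ℝ) ^ 3 * β) k *
                levelValue su2Rep L β 0 * l2 (fun U => ∑ i, a i * F i U) (fun U => ∑ i, a i * F i U))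
    (hshell : InnerShellGainAt L δc δ) :
    ∃ C βI : ℝ, ∀ β : ℝ, βI ≤ β →
      ∀ F : Fin (k + 1) → (GaugeConfig 3 L SU2 → ℝ), (∀ i, IsPhys (F i)) →
        (∀ i U, F i U ≠ 0 → ∃ z : Fin 3 → Bool, orbitDist (TT.twist3 z U) < δ β) →
        (∀ a : Fin (k + 1) → ℝ, a ≠ 0 → 0 < l2 (fun U => ∑ i, a i * F i U) (fun U => ∑ i, a i * F i U)) →
          ∃ a : Fin (k + 1) → ℝ, a ≠ 0 ∧
            qform su2Rep β (fun U => ∑ i, a i * F i U) (fun U => ∑ i, a i * F i U) * levelValue su2Rep 1 ((L : ℝ) ^ 3 * β) 0 ≤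
              Real.exp (C * bareLambda ((L : ℝ) ^ 3 * β) ^ 2) * levelValue su2Rep 1 ((L : ℝ) ^ 3 * β) k *
                levelValue su2Rep L β 0 * l2 (fun U => ∑ i, a i * F i U) (fun U => ∑ i, a i * F i U) := by
  classical
  obtain ⟨C, βc, hC⟩ := hcore
  obtain ⟨β1, hadm'⟩ := hadm
  obtain ⟨C1, B0, hONE⟩ := oneSiteLevels_proof k
  set A : ℝ := |levelGap k| + |C1| + 1 with hAdef
  obtain ⟨βS, hS⟩ := hshell A
  have hL1 : (1 : ℝ) ≤ (L : ℝ) ^ 3 := one_le_pow₀ (by exact_mod_cast NeZero.one_le)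
  have hτ0 : (0 : ℝ) < 1 / (2 * (|levelGap k| + |C1| + 2)) := by positivity
  refine ⟨|C| + 2 * D, max (max (max βc β1) (max βS 1)) (max B0 (2 / (1 / (2 * (|levelGap k| + |C1| + 2))) ^ 3)), fun β hβ F hF hFs hGram => ?_⟩
  have hβc : βc ≤ β := (((le_max_left _ _).trans (le_max_left _ _)).trans (le_max_left _ _)).trans hβ
  have hβ1 : β1 ≤ β := (((le_max_right _ _).trans (le_max_left _ _)).trans (le_max_left _ _)).trans hβ
  have hβS : βS ≤ β := (((le_max_left _ _).trans (le_max_right _ _)).trans (le_max_left _ _)).trans hβ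
  have hβone : 1 ≤ β := (((le_max_right _ _).trans (le_max_right _ _)).trans (le_max_left _ _)).trans hβ
  have hβB0 : B0 ≤ β := ((le_max_left _ _).trans (le_max_right _ _)).trans hβ
  have hβτ : 2 / (1 / (2 * (|levelGap k| + |C1| + 2))) ^ 3 ≤ β := ((le_max_right _ _).trans (le_max_right _ _)).trans hβ
  have hβ0 : 0 < β := by linarith
  set B : ℝ := (L : ℝ) ^ 3 * β with hBdef
  have hBβ : β ≤ B := by rw [hBdef]; nlinarith
  have hB0 : 0 < B := lt_of_lt_of_le hβ0 hBβ
  set lam : ℝ := bareLambda B with hlam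
  have hlam0 : 0 < lam := bareLambda_pos' hB0
  have hlamτ : lam ≤ 1 / (2 * (|levelGap k| + |C1| + 2)) := bareLambda_cube_le (L := L) hτ0 hβτ
  obtain ⟨-, hy2, hy⟩ := smallness_of_le hlam0.le hlamτ
  have hlam1 : lam ≤ 1 := by
    have h22 : 1 / (2 * (|levelGap k| + |C1| + 2)) ≤ 1 := by
      rw [div_le_one (by positivity)]; nlinarith [abs_nonneg (levelGap k), abs_nonneg C1]
    exact hlamτ.trans h22
  -- one-site levels at `B`
  obtain ⟨hμ0, -, hμk⟩ := hONE B (hβB0.trans hBβ)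
  set μ0 : ℝ := levelValue su2Rep 1 B 0 with hμ0def
  set μk : ℝ := levelValue su2Rep 1 B k with hμkdef
  have hμk' : Real.exp (-(levelGap k * lam + |C1| * lam ^ 2)) * μ0 ≤ μk := by
    refine le_trans (mul_le_mul_of_nonneg_right (Real.exp_le_exp.2 ?_) hμ0.le) hμk
    have := mul_le_mul_of_nonneg_right (le_abs_self C1) (sq_nonneg lam)
    linarith
  have hμk2 : μ0 / 2 ≤ μk := half_le_of_exp_lower hy hμ0.le hμk'
  have hμkpos : 0 < μk := by linarith
  -- `e^{−Aλ} μ₀ ≤ μ_k`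
  have hAμ : Real.exp (-(A * lam)) * μ0 ≤ μk := by
    refine le_trans (mul_le_mul_of_nonneg_right (Real.exp_le_exp.2 ?_) hμ0.le) hμk'
    have h1 : levelGap k * lam ≤ |levelGap k| * lam := mul_le_mul_of_nonneg_right (le_abs_self _) hlam0.le
    have h2 : |C1| * lam ^ 2 ≤ |C1| * lam := mul_le_mul_of_nonneg_left (by nlinarith) (abs_nonneg C1)
    rw [hAdef]; nlinarith
  -- the floor and the IMS defect
  have hΛ0 : 0 < levelValue su2Rep L β 0 := levelValue_su2Rep_pos hβ0 0
  set Λ : ℝ := levelValue su2Rep L β 0 with hΛdef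
  obtain ⟨hδc0, hdef⟩ := hadm' β hβ1
  have hdef' : (1 / 2) * ((Fintype.card (Edge 3 L) : ℝ) ^ 2 * (8 * π / δc β) ^ 2 * (3 / β) * latCE L β) ≤ D * lam ^ 2 * Λ := by
    refine hdef.trans ?_
    rw [← hBdef, ← hlam]
    exact mul_le_mul_of_nonneg_left (levelValue_zero_ge_uniform (L := L) hβone) (by positivity)
  -- the family and its pieces
  set Θ : GaugeConfig 3 L SU2 → ℝ := innerPhase (δc β) with hΘdef
  set Fc : Fin (k + 1) → GaugeConfig 3 L SU2 → ℝ := fun i U => Real.cos (Θ U) * F i U with hFcdef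
  have hFc : ∀ i, IsPhys (Fc i) := fun i => isPhys_inner (δc β) (hF i)
  have hFcs : ∀ i U, Fc i U ≠ 0 → ∃ z : Fin 3 → Bool, orbitDist (TT.twist3 z U) < δc β := fun i U hU =>
    exists_orbitDist_lt_of_cos_ne_zero hδc0 (left_ne_zero_of_mul hU)
  have hFa : ∀ a : Fin (k + 1) → ℝ, IsPhys (fun U => ∑ i, a i * F i U) := fun a => isPhys_sum_mul_lat Finset.univ F hF a
  have hcomb : ∀ a : Fin (k + 1) → ℝ, (fun U => ∑ i, a i * Fc i U) = fun U => Real.cos (Θ U) * ∑ i, a i * F i U := fun a => by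
    rw [cut_sum_mul]
  -- Step 1: a combination whose `cos`-piece obeys the CORE bound (or vanishes)
  have hstep1 : ∃ a : Fin (k + 1) → ℝ, a ≠ 0 ∧
      qform su2Rep β (fun U => ∑ i, a i * Fc i U) (fun U => ∑ i, a i * Fc i U) * μ0 ≤
        Real.exp (|C| * lam ^ 2) * μk * Λ * l2 (fun U => ∑ i, a i * Fc i U) (fun U => ∑ i, a i * Fc i U) := by
    by_cases hnd : ∀ a : Fin (k + 1) → ℝ, a ≠ 0 → 0 < l2 (fun U => ∑ i, a i * Fc i U) (fun U => ∑ i, a i * Fc i U)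
    · obtain ⟨a, ha, h⟩ := hC β hβc Fc hFc hFcs hnd
      refine ⟨a, ha, h.trans ?_⟩
      rw [← hBdef, ← hlam]
      refine mul_le_mul_of_nonneg_right (mul_le_mul_of_nonneg_right (mul_le_mul_of_nonneg_right (Real.exp_le_exp.2 ?_) hμkpos.le) hΛ0.le)
        (l2_self_nonneg_lat _)
      exact mul_le_mul_of_nonneg_right (le_abs_self C) (sq_nonneg lam)
    · push Not at hnd
      obtain ⟨a, ha, hle⟩ := hnd
      refine ⟨a, ha, ?_⟩
      have hphys := isPhys_sum_mul_lat Finset.univ Fc hFc a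
      obtain ⟨Ca, hCa⟩ := hphys.bounded
      have h0 : l2 (fun U => ∑ i, a i * Fc i U) (fun U => ∑ i, a i * Fc i U) = 0 := le_antisymm hle (l2_self_nonneg_lat _)
      have hsq : ∫ U, (∑ i, a i * Fc i U) ^ 2 ∂configMeasure SU2 L = 0 := by rw [← l2_self_eq_integral_sq]; exact h0
      rw [qform_eq_zero_of_integral_sq_eq_zero β hphys.measurable hCa hsq, h0]; simp
  obtain ⟨a, ha, hcos⟩ := hstep1
  refine ⟨a, ha, ?_⟩
  set Fa : GaugeConfig 3 L SU2 → ℝ := fun U => ∑ i, a i * F i U with hFadef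
  have hFa' : IsPhys Fa := hFa a
  -- Step 2: the `sin`-piece sits in the shell
  have hFas : ∀ U, Fa U ≠ 0 → ∃ z : Fin 3 → Bool, orbitDist (TT.twist3 z U) < δ β := fun U hU => by
    obtain ⟨i, hi⟩ := exists_ne_zero_of_combination_ne_zero hU
    exact hFs i U hi
  have hsin : qform su2Rep β (fun U => Real.sin (Θ U) * Fa U) (fun U => Real.sin (Θ U) * Fa U) ≤
      Real.exp (-(A * bareLambda ((L : ℝ) ^ 3 * β))) * Λ * l2 (fun U => Real.sin (Θ U) * Fa U) (fun U => Real.sin (Θ U) * Fa U) :=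
    hS β hβS _ (isPhys_outer (δc β) hFa') fun U hU =>
      ⟨hFas U (right_ne_zero_of_mul hU), forall_lt_orbitDist_of_sin_ne_zero hδc0 (left_ne_zero_of_mul hU)⟩
  rw [← hBdef, ← hlam] at hsin
  -- Step 3: the cut
  have hims := qform_le_inner_outer_lat hβ0 hδc0 hFa'
  have hsplit := l2_cos_add_l2_sin (measurable_innerPhase (δc β)) hFa'
  rw [hcomb a] at hcos
  -- Step 4: arithmetic
  set nc : ℝ := l2 (fun U => Real.cos (Θ U) * Fa U) (fun U => Real.cos (Θ U) * Fa U) with hnc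
  set ns : ℝ := l2 (fun U => Real.sin (Θ U) * Fa U) (fun U => Real.sin (Θ U) * Fa U) with hns
  set n : ℝ := l2 Fa Fa with hn
  have hnc0 : 0 ≤ nc := l2_self_nonneg_lat _
  have hns0 : 0 ≤ ns := l2_self_nonneg_lat _
  have hn0 : 0 ≤ n := l2_self_nonneg_lat _
  have hncs : nc + ns = n := hsplit
  have hexp1 : 1 ≤ Real.exp (|C| * lam ^ 2) := Real.one_le_exp (by positivity)
  -- sin-piece times μ₀: `e^{−Aλ}Λ μ₀ ns ≤ e^{|C|λ²} μk Λ ns`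
  have hsin' : qform su2Rep β (fun U => Real.sin (Θ U) * Fa U) (fun U => Real.sin (Θ U) * Fa U) * μ0 ≤ Real.exp (|C| * lam ^ 2) * μk * Λ * ns := by
    have h1 := mul_le_mul_of_nonneg_right hsin hμ0.le
    have h2 : Real.exp (-(A * lam)) * Λ * ns * μ0 = (Real.exp (-(A * lam)) * μ0) * (Λ * ns) := by ring
    have hμk1 : μk ≤ Real.exp (|C| * lam ^ 2) * μk := by
      have := mul_le_mul_of_nonneg_right hexp1 hμkpos.le; linarith
    have h3 : (Real.exp (-(A * lam)) * μ0) * (Λ * ns) ≤ (Real.exp (|C| * lam ^ 2) * μk) * (Λ * ns) :=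
      mul_le_mul_of_nonneg_right (hAμ.trans hμk1) (mul_nonneg hΛ0.le hns0)
    have h4 : (Real.exp (|C| * lam ^ 2) * μk) * (Λ * ns) = Real.exp (|C| * lam ^ 2) * μk * Λ * ns := by ring
    rw [h2] at h1
    linarith [h1, h3, h4]
  -- defect times μ₀: `D λ² Λ n μ₀ ≤ 2 D λ² μk Λ n`
  have hdef2 : (1 / 2) * ((Fintype.card (Edge 3 L) : ℝ) ^ 2 * (8 * π / δc β) ^ 2 * (3 / β) * latCE L β) * n * μ0 ≤ 2 * D * lam ^ 2 * μk * Λ * n := by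
    have h1 := mul_le_mul_of_nonneg_right (mul_le_mul_of_nonneg_right hdef' hn0) hμ0.le
    have h2 : D * lam ^ 2 * Λ * n * μ0 ≤ D * lam ^ 2 * Λ * n * (2 * μk) :=
      mul_le_mul_of_nonneg_left (by linarith) (by positivity)
    have e2 : D * lam ^ 2 * Λ * n * (2 * μk) = 2 * D * lam ^ 2 * μk * Λ * n := by ring
    linarith [h1, h2, e2]
  -- total
  have htot : qform su2Rep β Fa Fa * μ0 ≤ (Real.exp (|C| * lam ^ 2) + 2 * D * lam ^ 2) * μk * Λ * n := by
    have h1 := mul_le_mul_of_nonneg_right hims hμ0.le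
    have e1 : Real.exp (|C| * lam ^ 2) * μk * Λ * nc + Real.exp (|C| * lam ^ 2) * μk * Λ * ns = Real.exp (|C| * lam ^ 2) * μk * Λ * n := by
      rw [← hncs]; ring
    have e0 : (qform su2Rep β (fun U => Real.cos (Θ U) * Fa U) (fun U => Real.cos (Θ U) * Fa U) +
        qform su2Rep β (fun U => Real.sin (Θ U) * Fa U) (fun U => Real.sin (Θ U) * Fa U) +
        (1 / 2) * ((Fintype.card (Edge 3 L) : ℝ) ^ 2 * (8 * π / δc β) ^ 2 * (3 / β) * latCE L β) * n) * μ0 =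
        qform su2Rep β (fun U => Real.cos (Θ U) * Fa U) (fun U => Real.cos (Θ U) * Fa U) * μ0 +
        qform su2Rep β (fun U => Real.sin (Θ U) * Fa U) (fun U => Real.sin (Θ U) * Fa U) * μ0 +
        (1 / 2) * ((Fintype.card (Edge 3 L) : ℝ) ^ 2 * (8 * π / δc β) ^ 2 * (3 / β) * latCE L β) * n * μ0 := by ring
    rw [e0] at h1
    have e3 : (Real.exp (|C| * lam ^ 2) + 2 * D * lam ^ 2) * μk * Λ * n = Real.exp (|C| * lam ^ 2) * μk * Λ * n + 2 * D * lam ^ 2 * μk * Λ * n := by ring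
    linarith [h1, hcos, hsin', hdef2, e1, e3]
  have hexp2 : Real.exp (|C| * lam ^ 2) + 2 * D * lam ^ 2 ≤ Real.exp ((|C| + 2 * D) * lam ^ 2) := by
    have h1 : 1 + 2 * D * lam ^ 2 ≤ Real.exp (2 * D * lam ^ 2) := by have := Real.add_one_le_exp (2 * D * lam ^ 2); linarith
    have h2 : Real.exp (|C| * lam ^ 2) + 2 * D * lam ^ 2 ≤ Real.exp (|C| * lam ^ 2) * (1 + 2 * D * lam ^ 2) := by
      nlinarith [hexp1, mul_nonneg hD (sq_nonneg lam)]
    calc Real.exp (|C| * lam ^ 2) + 2 * D * lam ^ 2 ≤ Real.exp (|C| * lam ^ 2) * (1 + 2 * D * lam ^ 2) := h2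
      _ ≤ Real.exp (|C| * lam ^ 2) * Real.exp (2 * D * lam ^ 2) := mul_le_mul_of_nonneg_left h1 (Real.exp_pos _).le
      _ = Real.exp ((|C| + 2 * D) * lam ^ 2) := by rw [← Real.exp_add]; ring_nf
  calc qform su2Rep β Fa Fa * μ0 ≤ (Real.exp (|C| * lam ^ 2) + 2 * D * lam ^ 2) * μk * Λ * n := htot
    _ ≤ Real.exp ((|C| + 2 * D) * lam ^ 2) * μk * Λ * n :=
        mul_le_mul_of_nonneg_right (mul_le_mul_of_nonneg_right (mul_le_mul_of_nonneg_right hexp2 hμkpos.le) hΛ0.le) hn0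

/-! ## §2 ★ The core radius `c·√λ_b(L³β)` is rate-admissible -/

/-- ★ **The core radius `δc β := c·√λ_b(L³β)` (`c > 0`) is rate-admissible**: eventually `0 < δc β` and the IMS defect at radius `δc β` is
`≤ (48π²|E|²L³/(c²·uniformFloorConst L))·λ_b(L³β)²·(uniformFloorConst L·c_β^{|E|})` — since `β·λ_b(L³β)³·L³ = 2`. [folklore] -/
theorem coreRadius_admissible {c : ℝ} (hc : 0 < c) :
    ∃ β1 : ℝ, ∀ β : ℝ, β1 ≤ β → 0 < c * Real.sqrt (bareLambda ((L : ℝ) ^ 3 * β)) ∧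
      (1 / 2) * ((Fintype.card (Edge 3 L) : ℝ) ^ 2 * (8 * π / (c * Real.sqrt (bareLambda ((L : ℝ) ^ 3 * β)))) ^ 2 * (3 / β) * latCE L β) ≤
        (48 * π ^ 2 * (Fintype.card (Edge 3 L) : ℝ) ^ 2 * (L : ℝ) ^ 3 / (c ^ 2 * uniformFloorConst L)) * bareLambda ((L : ℝ) ^ 3 * β) ^ 2 *
          (uniformFloorConst L * latCE L β) := by
  have hL1 : (1 : ℝ) ≤ (L : ℝ) ^ 3 := one_le_pow₀ (by exact_mod_cast NeZero.one_le)
  have hu := uniformFloorConst_pos (L := L)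
  refine ⟨1, fun β hβ => ?_⟩
  have hβ0 : 0 < β := by linarith
  set B : ℝ := (L : ℝ) ^ 3 * β with hBdef
  have hB0 : 0 < B := by positivity
  set lam := bareLambda B with hlam
  have hlam0 : 0 < lam := bareLambda_pos' hB0
  have hsq0 : 0 < Real.sqrt lam := Real.sqrt_pos.2 hlam0
  have hCE := (latCE_pos (L := L) hβ0.le).le
  refine ⟨mul_pos hc hsq0, ?_⟩
  -- `(8π/(c√λ))² = 64π²/(c²λ)` and `3/β = (3/2)·L³·λ³`
  have hcube : B * lam ^ 3 = 2 := by
    have := bareLambda_half_cube hB0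
    rw [← hlam] at this
    nlinarith [this]
  have h1 : (8 * π / (c * Real.sqrt lam)) ^ 2 = 64 * π ^ 2 / (c ^ 2 * lam) := by
    rw [div_pow, mul_pow, mul_pow, Real.sq_sqrt hlam0.le]; ring
  have h3 : 3 / β = 3 / 2 * (L : ℝ) ^ 3 * lam ^ 3 := by
    have hcube' : β * ((L : ℝ) ^ 3 * lam ^ 3) = 2 := by rw [hBdef] at hcube; linear_combination hcube
    rw [div_eq_iff hβ0.ne']
    linear_combination (-(3 : ℝ) / 2) * hcube'
  rw [h1, h3]
  have e : (1 / 2) * ((Fintype.card (Edge 3 L) : ℝ) ^ 2 * (64 * π ^ 2 / (c ^ 2 * lam)) * (3 / 2 * (L : ℝ) ^ 3 * lam ^ 3) * latCE L β) =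
      (48 * π ^ 2 * (Fintype.card (Edge 3 L) : ℝ) ^ 2 * (L : ℝ) ^ 3 / (c ^ 2 * uniformFloorConst L)) * lam ^ 2 * (uniformFloorConst L * latCE L β) := by
    field_simp
    ring
  rw [e]

/-! ## §3 ★★★★ K1 ⟸ CORE RATE + SHELL -/

/-- ★★★★ **K1 `NearFlatRatioLaw` ⟸ for every `L ≥ 2`: the CORE RATE at `k = 1` on radius `c_L·√λ_b(L³β)` (`c_L > 0`) and lane A's SHELL GAIN `InnerShellGainAt L (c_L√λ_b(L³·)) (β^{−1/40})`.**
(`innerRate_of_core_shell` at `k = 1` with `coreRadius_admissible`, then `nearFlatRatioLaw_of_innerRate`.) [cite: Luscher1983, §3] -/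
theorem nearFlatRatioLaw_of_coreRate_shell (c : ℕ → ℝ) (hc : ∀ L, 0 < c L)
    (hcore : ∀ (L : ℕ) [NeZero L], 2 ≤ L → ∃ C βc : ℝ, ∀ β : ℝ, βc ≤ β →
      ∀ F : Fin 2 → (GaugeConfig 3 L SU2 → ℝ), (∀ i, IsPhys (F i)) →
        (∀ i U, F i U ≠ 0 → ∃ z : Fin 3 → Bool, orbitDist (TT.twist3 z U) < c L * Real.sqrt (bareLambda ((L : ℝ) ^ 3 * β))) →
        (∀ a : Fin 2 → ℝ, a ≠ 0 → 0 < l2 (fun U => ∑ i, a i * F i U) (fun U => ∑ i, a i * F i U)) →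
          ∃ a : Fin 2 → ℝ, a ≠ 0 ∧
            qform su2Rep β (fun U => ∑ i, a i * F i U) (fun U => ∑ i, a i * F i U) * levelValue su2Rep 1 ((L : ℝ) ^ 3 * β) 0 ≤
              Real.exp (C * bareLambda ((L : ℝ) ^ 3 * β) ^ 2) * levelValue su2Rep 1 ((L : ℝ) ^ 3 * β) 1 *
                levelValue su2Rep L β 0 * l2 (fun U => ∑ i, a i * F i U) (fun U => ∑ i, a i * F i U))
    (hshell : ∀ (L : ℕ) [NeZero L], 2 ≤ L → InnerShellGainAt L (fun β => c L * Real.sqrt (bareLambda ((L : ℝ) ^ 3 * β))) (powScale (1 / 40))) :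
    Summit.QuantumFields.YangMills.Theses.FlatTubeReduction.NearFlatRatioLaw :=
  Summit.QuantumFields.YangMills.Theorems.FlatTubeReduction.nearFlatRatioLaw_of_innerRate fun L _ hL => by
    obtain ⟨β1, hadm⟩ := coreRadius_admissible (L := L) (hc L)
    exact innerRate_of_core_shell (L := L) 1 (D := 48 * π ^ 2 * (Fintype.card (Edge 3 L) : ℝ) ^ 2 * (L : ℝ) ^ 3 / (c L ^ 2 * uniformFloorConst L))
      (by have := uniformFloorConst_pos (L := L); have := hc L; positivity) ⟨β1, hadm⟩ (hcore L hL) (hshell L hL)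

end Summit.QuantumFields.YangMills.Theorems.FemtoTransferGap.RateTube

end
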